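import Literature.NumberTheory.EllipticCurves.RankinSelbergEulerProductHeckeProofs
import Literature.NumberTheory.EllipticCurves.KatzPAdicLFunctionCMField
import Literature.NumberTheory.GaloisRepresentations.HeckeLFunctionNonvanishingLineProofs
import Literature.NumberTheory.GaloisRepresentations.HeckeCharacterModulusExponentProofs
import Literature.NumberTheory.GaloisRepresentations.HeckeCharacterInfinityTypeNormTwistProofs
import Literature.NumberTheory.GaloisRepresentations.GlobalArtinMapNormProofs
import Mathlib.NumberTheory.RamificationInertia.Galois
import HarnessLib

/-!
# The Rankin–Selberg Euler product `L(f/K, χ, s)` as a Hecke `L`-function OVER AN EXTENSION `L ⊃ K`: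
# regrouping `∏_w` over the primes of `L` by the prime of `K` below, and the local-to-global step of the
# Artin formalism `L(s, π_{f,K} ⊗ χ) = L_L(s, η · χ∘N_{L/K})` for an induced (CM / dihedral) form

Topic `NumberTheory/EllipticCurves` (namespace `Literature.NumberTheory.EllipticCurves`). PROOFS ONLY (no
definition, no named fact, no `sorry`). Requested by route `BiquadraticEisensteinDescent` of
`Summits/BirchSwinnertonDyer` (crux `EisensteinHeartFlatCMInertBadKPrime`, line `hsieh-lambda`, layer 2 (V2),
hypothesis (L) of `…KatzHsiehDisplay.exists_span_C_mul_eq`: for the CM newform `f = θ_{ψ_W}` of `W` (CM by `K_CM`),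
a second imaginary quadratic field `K = K′`, `L = K_CM·K′` and `η = ψ_W ∘ N_{L/K_CM}`, the identity of Euler
products `L_L(η · χ∘N_{L/K′}, s) = L(f/K′, χ, s)`, `re s > 3/2` — Silverman, *Advanced Topics* II Thm. 10.5 (b)
with Ex. 2.30–2.32 is the case `χ = 1`; the companion `RankinSelbergValueHeckeShiftedContinuationProofs` turns it
into the value identity (L)). This file is the GLOBAL half, reducing the identity to a LOCAL one, in the pattern of
`RankinSelbergEulerProductHeckeRegroupProofs` (there: `∏_v` over `K` regrouped by the rational prime below; here:
`∏_w` over `L` regrouped by the prime of `K` below):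

* `finite_fiber_under`, `HasProd.under_regroup` — the fibres `{w ∣ v}` of `HeightOneSpectrum.under` are finite and
  an unconditionally convergent product over the primes of `L` regroups as `∏_v ∏_{w ∣ v}`
  (`HasProd.sigma` along `Equiv.sigmaFiberEquiv`; the relative form of `PrimesOverRegroup`).
* `hasProd_heckeLFunction_ite`, `hasProd_heckeLFunction_fiberwise` — for a Hecke character `μ` of `L` of exponent `σ`
  (`‖μ(x)‖ = ‖x‖^σ`, so `|μ(ϖ_w)| = N(w)^{−σ}`) and `re s > 1 − σ`, `L(μ, s) = ∏_w (1 − μ̃(w) N(w)^{−s})⁻¹`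
  converges (all places, `μ̃` = `heckeValueExtZero`) and `= ∏_v ∏_{w ∣ v} (…)⁻¹`.
* `heckeLFunction_eq_rankinSelbergEulerProductHecke_of_local` — hence `L(μ, s) = L(f/K, χ, s)`
  (`rankinSelbergEulerProductHecke`, the tree's Euler product over the primes of `K`) as soon as, prime by prime,
  `rankinSelbergLocalFactorInvHecke f χ v s = ∏_{w ∣ v} (1 − μ̃(w) N(w)^{−s})`.
* `localFactor_eq_finprod_of_polynomial_identity` — that local identity for `μ = η · χ∘N_{L/K}` (`χ` unramified)
  from the POLYNOMIAL identity `1 − t_v X + e_v^{k} X² = ∏_{w ∣ v} (1 − η̃(w) X^{f(w|v)})` (Deuring's theorem read over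
  `K′`, Silverman II Ex. 2.32 (a): split `(1 − ηX)(1 − η′X)`, inert `1 − ηX²`, ramified `1`) together with
  "`η` is ramified above the primes of `K` ramified in `L`" — using `(χ∘N)(ϖ_w) = χ(ϖ_v)^{f(w|v)}`
  (`compRelNorm_valueAtUniformizer`) and `N(w) = N(v)^{f(w|v)}`.
* **`heckeLFunction_mul_compRelNorm_eq_rankinSelbergEulerProductHecke`** (all `s` with `re s > 1 − σ`) and its
  shift **`heckeLFunction_mul_norm_mul_compRelNorm_eq`**: for `λ = η · ‖·‖` (`= ψ_L · N_L⁻¹` of the route),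
  `L(λ · χ∘N, s − 1) = L(f/K, χ, s)` on `re s > 3/2` when `σ = −1/2` (weight-`2` CM: `|ψ(ϖ)| = N^{1/2}`) — the
  hypothesis `hEP` of `hLval_of_hasKatzType_of_heckeLFunction_eq` with `c_L = c_L′ = 1`.

What is NOT here: the local polynomial identities themselves at the route's frame (Deuring's theorem
`Deuring_exists_heckeCharacter_of_maximalCM` (iv) transported to the primes of `K′` through the splitting of primes in
the biquadratic field) — an instantiation step.

References: [SilvermanATAEC1994] Ch. II Thm. 10.5 (b), Ex. 2.30–2.32 (p. 171–179); [NeukirchANT1999] Ch. VII (8.1)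
(absolute convergence), (10.4)(iv) (inductivity); [Gross2004] §3, §13 (`L(f/K, χ, s)` as an automorphic
`L`-function); [Nekovar1995] (0.5), §3.4; [CasselsFrohlichANT1967] Ch. VII §4.3 (`χ ∘ N`).
-/

noncomputable section

open scoped NumberField
open NumberField IsDedekindDomain Ideal Complex CongruenceSubgroup
open Literature.NumberTheory.GaloisRepresentations
open Literature.NumberTheory.EllipticCurves.ModularForms

namespace Literature.NumberTheory.EllipticCurves

variable {K : Type} [Field K] [NumberField K] {L : Type} [Field L] [NumberField L] [Algebra K L] {N : ℕ}

/-! ### §1 Regrouping a product over the primes of `L` by the prime of `K` below -/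

/-- The primes of `L` above a given prime `v` of `K` form a finite set (they inject into Mathlib's finite
`primesOver v`). [cite: NeukirchANT1999, Ch. I §8 (8.2)–(8.3)] -/
theorem finite_fiber_under (v : HeightOneSpectrum (𝓞 K)) :
    Finite {w : HeightOneSpectrum (𝓞 L) // w.under (𝓞 K) = v} := by
  haveI := v.isMaximal
  haveI : Finite (v.asIdeal.primesOver (𝓞 L)) :=
    (IsDedekindDomain.primesOver_finite v.asIdeal (𝓞 L)).to_subtype
  refine Finite.of_injective (fun w : {w : HeightOneSpectrum (𝓞 L) // w.under (𝓞 K) = v} ↦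
    (⟨w.1.asIdeal, w.1.isPrime, ⟨show v.asIdeal = (w.1.under (𝓞 K)).asIdeal by rw [w.2]⟩⟩ :
      v.asIdeal.primesOver (𝓞 L))) ?_
  intro a b h
  exact Subtype.ext (HeightOneSpectrum.ext (congrArg Subtype.val h))

/-- The fibre `{w ∣ v}` as a set is finite. [cite: NeukirchANT1999, Ch. I §8 (8.2)–(8.3)] -/
theorem setOf_under_eq_finite (v : HeightOneSpectrum (𝓞 K)) :
    ({w : HeightOneSpectrum (𝓞 L) | w.under (𝓞 K) = v} : Set (HeightOneSpectrum (𝓞 L))).Finite :=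
  Set.finite_coe_iff.mp (finite_fiber_under v)

omit [NumberField K] [NumberField L] in
/-- The finite product over the fibre `{w ∣ v}` (as a subtype) is the `finprod` over the fibre (as a set).
[cite: NeukirchANT1999, Ch. I §8 (8.2)–(8.3)] -/
theorem prod_fiber_under_eq_finprod_mem (G : HeightOneSpectrum (𝓞 L) → ℂ) (v : HeightOneSpectrum (𝓞 K))
    [Fintype {w : HeightOneSpectrum (𝓞 L) // w.under (𝓞 K) = v}] :
    ∏ w : {w : HeightOneSpectrum (𝓞 L) // w.under (𝓞 K) = v}, G w.1 =
      ∏ᶠ w ∈ {w : HeightOneSpectrum (𝓞 L) | w.under (𝓞 K) = v}, G w := by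
  classical
  letI : Fintype ↥({w : HeightOneSpectrum (𝓞 L) | w.under (𝓞 K) = v} : Set (HeightOneSpectrum (𝓞 L))) :=
    ‹Fintype {w : HeightOneSpectrum (𝓞 L) // w.under (𝓞 K) = v}›
  rw [← finprod_set_coe_eq_finprod_mem, finprod_eq_prod_of_fintype]
  rfl

/-- **Regrouping an unconditionally convergent product over the primes of `L` by the prime of `K` below**:
if `∏_w G(w) = a` unconditionally then `∏_v (∏_{w ∣ v} G(w)) = a` unconditionally, the inner products being
finite. [cite: NeukirchANT1999, Ch. VII §8 (8.1)] -/
theorem HasProd.under_regroup {G : HeightOneSpectrum (𝓞 L) → ℂ} {a : ℂ} (h : HasProd G a) :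
    HasProd (fun v : HeightOneSpectrum (𝓞 K) ↦
      ∏ᶠ w ∈ {w : HeightOneSpectrum (𝓞 L) | w.under (𝓞 K) = v}, G w) a := by
  classical
  set e := Equiv.sigmaFiberEquiv (fun w : HeightOneSpectrum (𝓞 L) ↦ w.under (𝓞 K)) with he
  have h1 : HasProd (G ∘ e) a := (e.hasProd_iff).mpr h
  refine h1.sigma fun v ↦ ?_
  haveI : Fintype {w : HeightOneSpectrum (𝓞 L) // w.under (𝓞 K) = v} :=
    @Fintype.ofFinite _ (finite_fiber_under v)
  have h2 := hasProd_fintype (fun c : {w : HeightOneSpectrum (𝓞 L) // w.under (𝓞 K) = v} ↦ (G ∘ e) ⟨v, c⟩)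
  rwa [show (∏ c : {w : HeightOneSpectrum (𝓞 L) // w.under (𝓞 K) = v}, (G ∘ e) ⟨v, c⟩) =
      ∏ᶠ w ∈ {w : HeightOneSpectrum (𝓞 L) | w.under (𝓞 K) = v}, G w from ?_] at h2
  rw [← prod_fiber_under_eq_finprod_mem G v]
  rfl

/-! ### §2 The Hecke `L`-function over `L`, fibrewise over `K` -/

/-- `|μ̃(w)| ≤ N(w)^{−σ}` for a character of exponent `σ` (`= N(w)^{−σ}` at unramified `w`, `0` else).
[cite: WeilBNT1967, Ch. VII §7 (first paragraph)] -/
theorem norm_heckeValueExtZero_le_rpow {μ : HeckeCharacter L} {σ : ℝ}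
    (hσ : ∀ x : ideleGroup L, ‖((μ x : ℂˣ) : ℂ)‖ = ideleNorm x ^ σ) (w : HeightOneSpectrum (𝓞 L)) :
    ‖heckeValueExtZero μ w‖ ≤ ((Ideal.absNorm w.asIdeal : ℕ) : ℝ) ^ (-σ) := by
  by_cases h : μ.IsUnramifiedAt w
  · rw [heckeValueExtZero_of_isUnramifiedAt h, HeckeCharacter.norm_valueAtUniformizer_of_norm_eq_rpow hσ w]
  · rw [heckeValueExtZero_of_not_isUnramifiedAt h, norm_zero]
    exact Real.rpow_nonneg (Nat.cast_nonneg _) _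

/-- **`L(μ, s) = ∏_w (1 − μ̃(w) N(w)^{−s})⁻¹` converges (over ALL finite places of `L`) for `re s > 1 − σ`**, `σ` the
exponent of `μ` (`∑_w N(w)^{−(σ + re s)} < ∞`, Neukirch VII (8.1)). [cite: NeukirchANT1999, Ch. VII §8 (8.1)] -/
theorem hasProd_heckeLFunction_ite {μ : HeckeCharacter L} {σ : ℝ}
    (hσ : ∀ x : ideleGroup L, ‖((μ x : ℂˣ) : ℂ)‖ = ideleNorm x ^ σ) {s : ℂ} (hs : 1 < σ + s.re) :
    HasProd (fun w : HeightOneSpectrum (𝓞 L) ↦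
      (1 - heckeValueExtZero μ w * ((Ideal.absNorm w.asIdeal : ℕ) : ℂ) ^ (-s))⁻¹) (heckeLFunction μ s) := by
  classical
  -- summable majorant `N(w)^{-(σ + re s)}`
  have hmaj : Summable fun w : HeightOneSpectrum (𝓞 L) ↦
      ‖((Ideal.absNorm w.asIdeal : ℕ) : ℂ) ^ (-((σ + s.re : ℝ) : ℂ))‖ := by
    have h := Literature.NumberTheory.LFunctions.summable_norm_absNorm_cpow L (s := ((σ + s.re : ℝ) : ℂ))
      (by simpa using hs)
    have hi : Function.Injective fun w : HeightOneSpectrum (𝓞 L) ↦ w.asIdeal :=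
      fun v w hvw ↦ HeightOneSpectrum.ext hvw
    exact (h.comp_injective hi).congr fun w ↦ rfl
  have hsum : Summable fun w : HeightOneSpectrum (𝓞 L) ↦
      ‖heckeValueExtZero μ w * ((Ideal.absNorm w.asIdeal : ℕ) : ℂ) ^ (-s)‖ := by
    refine Summable.of_nonneg_of_le (fun _ ↦ norm_nonneg _) (fun w ↦ ?_) hmaj
    have hq : 0 < Ideal.absNorm w.asIdeal := Literature.NumberTheory.LFunctions.absNorm_heightOneSpectrum_pos w
    have hq' : (0 : ℝ) < (Ideal.absNorm w.asIdeal : ℕ) := Nat.cast_pos.mpr hq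
    rw [norm_mul, Complex.norm_natCast_cpow_of_pos hq, Complex.norm_natCast_cpow_of_pos hq, Complex.neg_re,
      Complex.neg_re, Complex.ofReal_re, neg_add, Real.rpow_add hq']
    exact mul_le_mul_of_nonneg_right (norm_heckeValueExtZero_le_rpow hσ w) (Real.rpow_nonneg hq'.le _)
  have hmult := Literature.NumberTheory.GaloisRepresentations.multipliable_inv_one_sub_of_summable_norm hsum
  have heq : heckeLFunction μ s = ∏' w : HeightOneSpectrum (𝓞 L),
      (1 - heckeValueExtZero μ w * ((Ideal.absNorm w.asIdeal : ℕ) : ℂ) ^ (-s))⁻¹ := by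
    rw [heckeLFunction_eq_tprod_ite]
    rfl
  rw [heq]
  exact hmult.hasProd

/-- **`L(μ, s) = ∏_v ∏_{w ∣ v} (1 − μ̃(w) N(w)^{−s})⁻¹`** (regrouped by the primes of `K ⊂ L`) for `re s > 1 − σ`.
[cite: NeukirchANT1999, Ch. VII §8 (8.1)] -/
theorem hasProd_heckeLFunction_fiberwise {μ : HeckeCharacter L} {σ : ℝ}
    (hσ : ∀ x : ideleGroup L, ‖((μ x : ℂˣ) : ℂ)‖ = ideleNorm x ^ σ) {s : ℂ} (hs : 1 < σ + s.re) :
    HasProd (fun v : HeightOneSpectrum (𝓞 K) ↦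
      ∏ᶠ w ∈ {w : HeightOneSpectrum (𝓞 L) | w.under (𝓞 K) = v},
        (1 - heckeValueExtZero μ w * ((Ideal.absNorm w.asIdeal : ℕ) : ℂ) ^ (-s))⁻¹) (heckeLFunction μ s) :=
  HasProd.under_regroup (hasProd_heckeLFunction_ite hσ hs)

/-- **`L(μ, s) = L(f/K, χ, s)` from the prime-by-prime identity of local factors**: if at every prime `v` of `K` the
inverse Rankin–Selberg local factor of `(f, χ)` at `s` is the product over `w ∣ v` of the inverse Hecke local factors
`1 − μ̃(w) N(w)^{−s}` of `μ`, and `re s > 1 − σ`, then `heckeLFunction μ s = rankinSelbergEulerProductHecke f χ s`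
(Artin formalism, global step; Neukirch VII (10.4)(iv)). [cite: NeukirchANT1999, Ch. VII (10.4)(iv)]
[cite: Gross2004, §3 and §13] -/
theorem heckeLFunction_eq_rankinSelbergEulerProductHecke_of_local {μ : HeckeCharacter L} {σ : ℝ}
    (hσ : ∀ x : ideleGroup L, ‖((μ x : ℂˣ) : ℂ)‖ = ideleNorm x ^ σ) {s : ℂ} (hs : 1 < σ + s.re)
    (f : CuspForm (Gamma0 N) 2) (χ : HeckeCharacter K)
    (hloc : ∀ v : HeightOneSpectrum (𝓞 K), rankinSelbergLocalFactorInvHecke f χ v s =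
      ∏ᶠ w ∈ {w : HeightOneSpectrum (𝓞 L) | w.under (𝓞 K) = v},
        (1 - heckeValueExtZero μ w * ((Ideal.absNorm w.asIdeal : ℕ) : ℂ) ^ (-s))) :
    heckeLFunction μ s = rankinSelbergEulerProductHecke f χ s := by
  have h := hasProd_heckeLFunction_fiberwise (K := K) hσ hs
  have h' : HasProd (fun v : HeightOneSpectrum (𝓞 K) ↦ (rankinSelbergLocalFactorInvHecke f χ v s)⁻¹)
      (heckeLFunction μ s) := by
    refine h.congr_fun fun v ↦ ?_  -- rewrite each regrouped factor
    rw [hloc v, finprod_mem_inv_distrib _ (setOf_under_eq_finite v)]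
  rw [rankinSelbergEulerProductHecke, h'.tprod_eq]

/-- **An anticyclotomic-type character is unitary**: on a totally complex `K`, a Hecke character of infinity type
`(n, −n)` (at every place) has exponent `0`, i.e. `|χ(x)| = 1` (`2σ = −(n − n)`). [cite: Weil1956, §1] -/
theorem isUnitary_of_hasInfinityType_self_neg [IsTotallyComplex K] {χ : HeckeCharacter K} {n : ℤ}
    (h : χ.HasInfinityType (fun _ ↦ n) (fun _ ↦ -n)) : χ.IsUnitary := by
  obtain ⟨σ, hσ⟩ := χ.exists_norm_apply_eq_ideleNorm_rpow
  have h2 := HeckeCharacter.two_mul_exponent_eq_of_hasInfinityType h hσ (Classical.arbitrary (InfinitePlace K))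
  have hσ0 : σ = 0 := by push_cast at h2; linarith
  intro x
  rw [hσ x, hσ0, Real.rpow_zero]

/-! ### §3 The local identity for `μ = η · χ∘N_{L/K}` from the polynomial identity at `v` -/

section Local

variable [IsGalois K L]

omit [IsGalois K L] in
/-- `(χψ)(ϖ_w) = χ(ϖ_w) ψ(ϖ_w)`. [cite: TateThesis1967, §2.5] -/
private theorem valueAtUniformizer_mul (χ ψ : HeckeCharacter L) (w : HeightOneSpectrum (𝓞 L)) :
    (χ * ψ).valueAtUniformizer w = χ.valueAtUniformizer w * ψ.valueAtUniformizer w := by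
  simp only [HeckeCharacter.valueAtUniformizer, HeckeCharacter.localComponent_apply, HeckeCharacter.mul_apply,
    Units.val_mul]

omit [IsGalois K L] in
/-- `N(w) = N(v)^{f(w|v)}` for `w ∣ v`. [cite: NeukirchANT1999, Ch. I §8 (8.2)] -/
theorem absNorm_eq_pow_inertiaDeg_under {w : HeightOneSpectrum (𝓞 L)} {v : HeightOneSpectrum (𝓞 K)}
    (hw : w.under (𝓞 K) = v) :
    Ideal.absNorm w.asIdeal = Ideal.absNorm v.asIdeal ^ w.asIdeal.inertiaDeg (𝓞 K) := by
  haveI : w.asIdeal.LiesOver v.asIdeal := ⟨by rw [← hw]; rfl⟩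
  haveI := v.isMaximal
  haveI := w.isMaximal
  rw [Ideal.absNorm_eq_pow_inertiaDeg'_of_liesOver w.asIdeal v.asIdeal v.isPrime v.ne_bot,
    Ideal.inertiaDeg'_eq_inertiaDeg v.asIdeal w.asIdeal]

/-- **`(χ∘N_{L/K})(ϖ_w) = χ(ϖ_v)^{f(w|v)}`** at `w ∣ v` with `v` unramified in `L` and `χ` unramified at `v`
(`L/K` Galois). [cite: CasselsFrohlichANT1967, Ch. VII §1.2 and §6.3] -/
theorem compRelNorm_valueAtUniformizer_eq_pow (χ : HeckeCharacter K) {w : HeightOneSpectrum (𝓞 L)}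
    {v : HeightOneSpectrum (𝓞 K)} (hw : w.under (𝓞 K) = v) (hunr : Algebra.IsUnramifiedIn (𝓞 L) v.asIdeal)
    (hχ : χ.IsUnramifiedAt v) :
    (χ.compRelNorm L).valueAtUniformizer w = χ.valueAtUniformizer v ^ w.asIdeal.inertiaDeg (𝓞 K) := by
  haveI : w.asIdeal.LiesOver v.asIdeal := ⟨by rw [← hw]; rfl⟩
  haveI := v.isMaximal
  have he : v.asIdeal.ramificationIdxIn (𝓞 L) = 1 := by
    rw [Ideal.ramificationIdxIn_eq_ramificationIdx v.asIdeal w.asIdeal (L ≃ₐ[K] L)]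
    exact hunr.ramificationIdx_eq_one inferInstance
  have hf : v.asIdeal.inertiaDegIn (𝓞 L) = w.asIdeal.inertiaDeg (𝓞 K) :=
    Ideal.inertiaDegIn_eq_inertiaDeg v.asIdeal w.asIdeal (L ≃ₐ[K] L)
  rw [χ.compRelNorm_valueAtUniformizer hw hunr hχ, he, one_mul, hf]
  rfl

/-- **The inverse Rankin–Selberg local factor at `v` as the product of the inverse Hecke local factors over `w ∣ v`**,
for `μ = η · χ∘N_{L/K}` with `χ` unramified everywhere, from (i) the POLYNOMIAL identity
`1 − t_v X + e_v^{k_v} X² = ∏_{w ∣ v} (1 − η̃(w) X^{f(w|v)})` in the notation of `rankinSelbergLocalFactorInvHecke`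
(`N(v) = ℓ^{k}`, `t_v = α_ℓ^k + β_ℓ^k`, `e_v = ℓ 𝟙_{ℓ ∤ N}`; Deuring / Silverman II Ex. 2.32 (a) over `K`) and (ii) `η` is
ramified above `v` whenever `v` ramifies in `L`: substitute `X = χ(ϖ_v) N(v)^{−s}` and use
`(χ∘N)(ϖ_w) = χ(ϖ_v)^{f}`, `N(w) = N(v)^{f}`. [cite: SilvermanATAEC1994, Ch. II Ex. 2.32 (a) (p. 179)]
[cite: NeukirchANT1999, Ch. VII (10.4)(iv)] -/
theorem localFactor_eq_finprod_of_polynomial_identity (f : CuspForm (Gamma0 N) 2) (η : HeckeCharacter L)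
    {χ : HeckeCharacter K} (hu : ∀ v : HeightOneSpectrum (𝓞 K), χ.IsUnramifiedAt v) (v : HeightOneSpectrum (𝓞 K))
    (hpoly : ∀ X : ℂ,
      1 - frobTracePow (cuspCoeff f (Ideal.absNorm v.asIdeal).minFac)
            (if (Ideal.absNorm v.asIdeal).minFac ∣ N then 0 else ((Ideal.absNorm v.asIdeal).minFac : ℂ))
            ((Ideal.absNorm v.asIdeal).factorization (Ideal.absNorm v.asIdeal).minFac) * X +
        (if (Ideal.absNorm v.asIdeal).minFac ∣ N then 0 else ((Ideal.absNorm v.asIdeal).minFac : ℂ)) ^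
            ((Ideal.absNorm v.asIdeal).factorization (Ideal.absNorm v.asIdeal).minFac) * X ^ 2 =
      ∏ᶠ w ∈ {w : HeightOneSpectrum (𝓞 L) | w.under (𝓞 K) = v},
        (1 - heckeValueExtZero η w * X ^ w.asIdeal.inertiaDeg (𝓞 K)))
    (hram : ¬ Algebra.IsUnramifiedIn (𝓞 L) v.asIdeal →
      ∀ w : HeightOneSpectrum (𝓞 L), w.under (𝓞 K) = v → ¬ η.IsUnramifiedAt w) (s : ℂ) :
    rankinSelbergLocalFactorInvHecke f χ v s =
      ∏ᶠ w ∈ {w : HeightOneSpectrum (𝓞 L) | w.under (𝓞 K) = v},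
        (1 - heckeValueExtZero (η * χ.compRelNorm L) w * ((Ideal.absNorm w.asIdeal : ℕ) : ℂ) ^ (-s)) := by
  set q : ℕ := Ideal.absNorm v.asIdeal with hq
  set X : ℂ := heckeValueExtZero χ v * ((q : ℕ) : ℂ) ^ (-s) with hX
  -- the Rankin–Selberg side is the polynomial at `X`
  have hRS : rankinSelbergLocalFactorInvHecke f χ v s =
      1 - frobTracePow (cuspCoeff f q.minFac) (if q.minFac ∣ N then 0 else (q.minFac : ℂ))
            (q.factorization q.minFac) * X +
        (if q.minFac ∣ N then 0 else (q.minFac : ℂ)) ^ (q.factorization q.minFac) * X ^ 2 := by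
    rw [rankinSelbergLocalFactorInvHecke_eq_one_sub, hX, show (-2 * s : ℂ) = (2 : ℕ) * (-s) by push_cast; ring,
      Complex.cpow_nat_mul]
    ring
  rw [hRS, hpoly X]
  refine finprod_mem_congr rfl fun w hw ↦ ?_
  have hw' : w.under (𝓞 K) = v := hw
  congr 1
  -- per `w`: `η̃(w) X^{f} = (η·χ∘N)~(w) N(w)^{-s}`
  have hχL : (χ.compRelNorm L).IsUnramifiedAt w := χ.compRelNorm_isUnramifiedAt (by rw [hw']; exact hu v)
  by_cases hη : η.IsUnramifiedAt w
  · have hunr : Algebra.IsUnramifiedIn (𝓞 L) v.asIdeal := by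
      by_contra h
      exact hram h w hw' hη
    have hμ : (η * χ.compRelNorm L).IsUnramifiedAt w := hη.mul' hχL
    have hqpos : 0 < q := Literature.NumberTheory.LFunctions.absNorm_heightOneSpectrum_pos v
    rw [heckeValueExtZero_of_isUnramifiedAt hη, heckeValueExtZero_of_isUnramifiedAt hμ, valueAtUniformizer_mul,
      compRelNorm_valueAtUniformizer_eq_pow χ hw' hunr (hu v), absNorm_eq_pow_inertiaDeg_under hw', hX,
      heckeValueExtZero_of_isUnramifiedAt (hu v), mul_pow, Nat.cast_pow, ← hq,
      ← Complex.cpow_nat_mul, ← Complex.natCast_cpow_natCast_mul]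
    ring
  · have hμ : ¬ (η * χ.compRelNorm L).IsUnramifiedAt w :=
      fun h ↦ hη ((KatzCM.isUnramifiedAt_mul_iff_of_range hχL).mp h)
    rw [heckeValueExtZero_of_not_isUnramifiedAt hη, heckeValueExtZero_of_not_isUnramifiedAt hμ, zero_mul,
      zero_mul]

end Local

/-! ### §4 `L_L(η · χ∘N_{L/K}, s) = L(f/K, χ, s)` and the shift by the norm character -/

section Global

variable [IsGalois K L]

/-- The exponent of `η · χ∘N_{L/K}` is that of `η` when `χ` is unitary (`|χ(N y)| = 1`).
[cite: WeilBNT1967, Ch. VII §3 (Cor. 1–2 of Prop. 7)] -/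
theorem norm_mul_compRelNorm_apply {η : HeckeCharacter L} {σ : ℝ}
    (hη : ∀ x : ideleGroup L, ‖((η x : ℂˣ) : ℂ)‖ = ideleNorm x ^ σ) {χ : HeckeCharacter K} (hχu : χ.IsUnitary)
    (x : ideleGroup L) : ‖(((η * χ.compRelNorm L) x : ℂˣ) : ℂ)‖ = ideleNorm x ^ σ := by
  rw [HeckeCharacter.mul_apply, Units.val_mul, norm_mul, hη, HeckeCharacter.compRelNorm_apply, hχu, mul_one]

/-- **`L_L(η · χ∘N_{L/K}, s) = L(f/K, χ, s)` as Euler products for `re s > 1 − σ`** (`σ` the exponent of `η`,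
`χ` unitary and unramified everywhere), granted at every prime `v` of `K` the polynomial identity
`1 − t_v X + e_v^{k_v} X² = ∏_{w ∣ v} (1 − η̃(w) X^{f(w|v)})` (Deuring's theorem over `K`, Silverman II Ex. 2.32 (a))
and that `η` is ramified above the primes of `K` ramified in `L` — Artin formalism for the induced form:
`L(s, π_{f,K} ⊗ χ) = L(s, Ind_L^K(η) ⊗ χ) = L_L(s, η · χ∘N)`. For the route: `f = θ_{ψ_W}`, `η = ψ_W ∘ N_{L/K_CM}`,
`L = K_CM·K′`. [cite: SilvermanATAEC1994, Ch. II Thm. 10.5 (b) and Ex. 2.32 (p. 171–179)]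
[cite: NeukirchANT1999, Ch. VII (10.4)(iv)] -/
theorem heckeLFunction_mul_compRelNorm_eq_rankinSelbergEulerProductHecke {η : HeckeCharacter L} {σ : ℝ}
    (hη : ∀ x : ideleGroup L, ‖((η x : ℂˣ) : ℂ)‖ = ideleNorm x ^ σ) {χ : HeckeCharacter K} (hχu : χ.IsUnitary)
    (hu : ∀ v : HeightOneSpectrum (𝓞 K), χ.IsUnramifiedAt v) (f : CuspForm (Gamma0 N) 2)
    (hpoly : ∀ (v : HeightOneSpectrum (𝓞 K)) (X : ℂ),
      1 - frobTracePow (cuspCoeff f (Ideal.absNorm v.asIdeal).minFac)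
            (if (Ideal.absNorm v.asIdeal).minFac ∣ N then 0 else ((Ideal.absNorm v.asIdeal).minFac : ℂ))
            ((Ideal.absNorm v.asIdeal).factorization (Ideal.absNorm v.asIdeal).minFac) * X +
        (if (Ideal.absNorm v.asIdeal).minFac ∣ N then 0 else ((Ideal.absNorm v.asIdeal).minFac : ℂ)) ^
            ((Ideal.absNorm v.asIdeal).factorization (Ideal.absNorm v.asIdeal).minFac) * X ^ 2 =
      ∏ᶠ w ∈ {w : HeightOneSpectrum (𝓞 L) | w.under (𝓞 K) = v},
        (1 - heckeValueExtZero η w * X ^ w.asIdeal.inertiaDeg (𝓞 K)))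
    (hram : ∀ v : HeightOneSpectrum (𝓞 K), ¬ Algebra.IsUnramifiedIn (𝓞 L) v.asIdeal →
      ∀ w : HeightOneSpectrum (𝓞 L), w.under (𝓞 K) = v → ¬ η.IsUnramifiedAt w)
    {s : ℂ} (hs : 1 < σ + s.re) :
    heckeLFunction (η * χ.compRelNorm L) s = rankinSelbergEulerProductHecke f χ s :=
  heckeLFunction_eq_rankinSelbergEulerProductHecke_of_local (norm_mul_compRelNorm_apply hη hχu) hs f χ
    fun v ↦ localFactor_eq_finprod_of_polynomial_identity f η hu v (hpoly v) (hram v) s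

/-- **The shift by the norm character**: for `λ = η · ν` with `ν(x) = ‖x‖` (the route's `λ = ψ_L · N_L⁻¹`, so that
`L(λ · χ∘N, 0) = L(ψ_L · χ∘N, 1)`) and `η` of exponent `−1/2` (weight `2`: `|ψ(ϖ)| = N(ϖ)^{1/2}`),
`L_L(λ · χ∘N_{L/K}, s − 1) = L(f/K, χ, s)` as Euler products for `re s > 3/2` — the hypothesis `hEP` of
`hLval_of_hasKatzType_of_heckeLFunction_eq` with `c_L = c_L′ = 1`. [cite: TateThesis1967, §4.4]
[cite: SilvermanATAEC1994, Ch. II Thm. 10.5 (b) (p. 171–172)] -/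
theorem heckeLFunction_mul_norm_mul_compRelNorm_eq {η : HeckeCharacter L}
    (hη : ∀ x : ideleGroup L, ‖((η x : ℂˣ) : ℂ)‖ = ideleNorm x ^ (-(1 / 2 : ℝ))) {ν : HeckeCharacter L}
    (hν : ∀ x : ideleGroup L, ((ν x : ℂˣ) : ℂ) = ((ideleNorm x : ℝ) : ℂ) ^ (1 : ℂ)) {χ : HeckeCharacter K}
    (hχu : χ.IsUnitary) (hu : ∀ v : HeightOneSpectrum (𝓞 K), χ.IsUnramifiedAt v) (f : CuspForm (Gamma0 N) 2)
    (hpoly : ∀ (v : HeightOneSpectrum (𝓞 K)) (X : ℂ),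
      1 - frobTracePow (cuspCoeff f (Ideal.absNorm v.asIdeal).minFac)
            (if (Ideal.absNorm v.asIdeal).minFac ∣ N then 0 else ((Ideal.absNorm v.asIdeal).minFac : ℂ))
            ((Ideal.absNorm v.asIdeal).factorization (Ideal.absNorm v.asIdeal).minFac) * X +
        (if (Ideal.absNorm v.asIdeal).minFac ∣ N then 0 else ((Ideal.absNorm v.asIdeal).minFac : ℂ)) ^
            ((Ideal.absNorm v.asIdeal).factorization (Ideal.absNorm v.asIdeal).minFac) * X ^ 2 =
      ∏ᶠ w ∈ {w : HeightOneSpectrum (𝓞 L) | w.under (𝓞 K) = v},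
        (1 - heckeValueExtZero η w * X ^ w.asIdeal.inertiaDeg (𝓞 K)))
    (hram : ∀ v : HeightOneSpectrum (𝓞 K), ¬ Algebra.IsUnramifiedIn (𝓞 L) v.asIdeal →
      ∀ w : HeightOneSpectrum (𝓞 L), w.under (𝓞 K) = v → ¬ η.IsUnramifiedAt w)
    {s : ℂ} (hs : 3 / 2 < s.re) :
    heckeLFunction (η * ν * χ.compRelNorm L) (s - 1) = rankinSelbergEulerProductHecke f χ s := by
  rw [mul_right_comm, HeckeCharacter.heckeLFunction_mul_eq_of_forall_apply_eq_cpow _ hν, sub_add_cancel]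
  exact heckeLFunction_mul_compRelNorm_eq_rankinSelbergEulerProductHecke hη hχu hu f hpoly hram (by linarith)

/-- **The Euler-product hypothesis `hEP` of `hLval_of_hasKatzType_of_heckeLFunction_eq`, with `c_L = c_L′ = 1`, for
`λ = η · ν`** on Hsieh's range (`χ` unramified of type `(n, −n)` on a totally complex `K`, hence unitary), granted the
local polynomial identities for `η` and the ramification of `η` above the primes ramified in `L/K`.
[cite: SilvermanATAEC1994, Ch. II Thm. 10.5 (b) and Ex. 2.32 (p. 171–179)] [cite: NeukirchANT1999, Ch. VII (10.4)(iv)] -/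
theorem hEP_of_polynomial_identities [IsTotallyComplex K] {η : HeckeCharacter L}
    (hη : ∀ x : ideleGroup L, ‖((η x : ℂˣ) : ℂ)‖ = ideleNorm x ^ (-(1 / 2 : ℝ))) {ν : HeckeCharacter L}
    (hν : ∀ x : ideleGroup L, ((ν x : ℂˣ) : ℂ) = ((ideleNorm x : ℝ) : ℂ) ^ (1 : ℂ)) (f : CuspForm (Gamma0 N) 2)
    (hpoly : ∀ (v : HeightOneSpectrum (𝓞 K)) (X : ℂ),
      1 - frobTracePow (cuspCoeff f (Ideal.absNorm v.asIdeal).minFac)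
            (if (Ideal.absNorm v.asIdeal).minFac ∣ N then 0 else ((Ideal.absNorm v.asIdeal).minFac : ℂ))
            ((Ideal.absNorm v.asIdeal).factorization (Ideal.absNorm v.asIdeal).minFac) * X +
        (if (Ideal.absNorm v.asIdeal).minFac ∣ N then 0 else ((Ideal.absNorm v.asIdeal).minFac : ℂ)) ^
            ((Ideal.absNorm v.asIdeal).factorization (Ideal.absNorm v.asIdeal).minFac) * X ^ 2 =
      ∏ᶠ w ∈ {w : HeightOneSpectrum (𝓞 L) | w.under (𝓞 K) = v},
        (1 - heckeValueExtZero η w * X ^ w.asIdeal.inertiaDeg (𝓞 K)))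
    (hram : ∀ v : HeightOneSpectrum (𝓞 K), ¬ Algebra.IsUnramifiedIn (𝓞 L) v.asIdeal →
      ∀ w : HeightOneSpectrum (𝓞 L), w.under (𝓞 K) = v → ¬ η.IsUnramifiedAt w) :
    ∀ (χ : HeckeCharacter K) (n : ℕ), 0 < n → (∀ v : HeightOneSpectrum (𝓞 K), χ.IsUnramifiedAt v) →
      χ.HasInfinityType (fun _ ↦ (n : ℤ)) (fun _ ↦ -(n : ℤ)) →
      ∀ s : ℂ, 3 / 2 < s.re →
        heckeLFunction (η * ν * χ.compRelNorm L) (s - 1) = 1 * 1 ^ n * rankinSelbergEulerProductHecke f χ s :=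
  fun _ _ _ hu hi s hs ↦ by
    rw [one_pow, one_mul, one_mul]
    exact heckeLFunction_mul_norm_mul_compRelNorm_eq hη hν (isUnitary_of_hasInfinityType_self_neg hi) hu f
      hpoly hram hs

end Global

end Literature.NumberTheory.EllipticCurves

end
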